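import Summits.QuantumFields.YangMills.Theses.AllWindowsColdBox
import HarnessLib

/-!
# Route `AllWindowsColdBox` — glue item `BulkWindowSU2OfWindows` (stmt-QuantumFields-24008), PROVED BY NAME

LINE-16 «one-scale cluster window» (planner ym-idea-2 g11; critic idea-crit-4 PASS 2026-08-29T02:27:34Z) splits the
open crux `BulkWindowSU2` (23030) at the separation exponent `A = 1/320` into `BulkMidWindowSU2` (24006, `A ≤ 1/320`)
and `BulkHighWindowSU2` (24007, `1/320 < A`).  This file lands the case-split glue
`BulkMidWindowSU2 → BulkHighWindowSU2 → BulkWindowSU2` (= the ideator's HOME `l16/Sketch.lean`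
`bulkWindowSU2_of_windows`, `rcases le_or_gt A (1/320)`).

HONEST LABEL: 4-line plumbing; both window cruxes are OPEN; no rung (R2ξ″ is a RECORD label) and no summit is
proved; the Yang–Mills mass gap is NOT proved.  Width seat `ym-line-sfw-p2-w3` g33 (cell ym-idea-1, free hands).
-/

set_option autoImplicit false

namespace Summit.QuantumFields.YangMills.Theorems.AllWindowsColdBox

open Summit.QuantumFields.YangMills.Theses.AllWindowsColdBox

/-- **Glue `BulkWindowSU2OfWindows` (stmt-QuantumFields-24008)**: the mid window (`A ≤ 1/320`) and the high
window (`1/320 < A`) together give the parent `BulkWindowSU2` — case split on `A ≤ 1/320`. [folklore] -/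
theorem bulkWindowSU2OfWindows_proof :
    Summit.QuantumFields.YangMills.Theses.AllWindowsColdBox.BulkWindowSU2OfWindows := by
  intro hmid hhigh A hA
  rcases le_or_gt A (1 / 320) with h | h
  · exact hmid A hA h
  · exact hhigh A hA h

end Summit.QuantumFields.YangMills.Theorems.AllWindowsColdBox
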